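import Literature.AlgebraicGeometry.HodgeTheory.AbelianVarietyCyclotomicAutomorphismCrossedProductIsotypicImages
import Literature.AlgebraicGeometry.HodgeTheory.AbelianVarietyCyclotomicAutomorphismTwistCharacters
import HarnessLib

/-!
# The crossed product `End⁰(A)`, XVI — THE CHARACTER TABLE IN CROSSED-PRODUCT COORDINATES: for
# `w = ∑_{v ∈ H} P_v(δ) x_v` (`x_v` a Galois twist of exponent `v`, `x_1 = 1`, `P_v ∈ ℤ[X]`) every Kani–Rosen character reads
# only the identity coordinate, `φ(m) · χ_B(w) = rank_ℤ Hom(A, B) · Tr_{ℚ(ζ_m)/ℚ}(P_1(ζ_m))`; hence for an integral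
# quasi-idempotent `u`, `N u = ∑_v P_v(δ) x_v`, `u² = a u`: `2aN · dim u(A) = Tr_{ℚ(ζ_m)/ℚ}(P_1(ζ_m))`, and the isogeny class,
# the simplicity and the vanishing of `u(A)` are read off `Tr(P_1(ζ_m))` (GEN 50, successor pointer (s7) of GEN 48–49)

Layer `Literature/AlgebraicGeometry/HodgeTheory`; theorems only (no `def`, no instance, no named fact; net debt 0).  Sequel of
GEN 48 row 1 (`…TwistCharacters`: `χ_B` VANISHES on twists of exponent `≠ 1`), GEN 49 row 5 (`…CrossedProductCharacterTable`:
`φ(m) · χ_B(P(δ)) = rank_ℤ Hom(A, B) · Tr_{ℚ(ζ_m)/ℚ}(P(ζ_m))`), GEN 49 rows 6–7 (`…IsotypicCriterion` ∕ `…IsotypicImages`: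
`2 · #H′ · a · dim u(A) = Tr_{End⁰(A)ᵒᵖ/ℚ}(op(1 ⊗ u))`; `u(A) ∼ v(A) ⟺ dim u(A) = dim v(A)`; `u(A)` simple ⟺
`#H′ · dim u(A) ≤ dim A`).

THE PRINT.  [Pierce1982] §16.3 Prop. b (PDF p0347): in a crossed product `A = ⊕_{σ∈G} u_σ E` the splitting representation
`φ(∑ u_ρ c_ρ) = [d_{στ}]`, `d_{στ} = Φ(στ⁻¹, τ) c^τ_{στ⁻¹}`, has diagonal `d_{σσ} = Φ(1,σ) c_1^σ`, so the reduced trace of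
`∑_ρ u_ρ c_ρ` is `T_{E/F}(c_1)` — every character of the central simple algebra reads only the identity coordinate `c_1`.
[Herstein1994] §4.4 Lemma 4.4.2 with proof (PDF p0077 L5–L9): `(K, G, 1) ≈ F_n`, `x = ∑ x_σ k_σ ↦ R_x`, `k R_x = ∑ k^σ k_σ`.
[Shimura1998] §5.1 Lemma 1 (PDF p0046) and Prop. 2 with proof (PDF p0047): a rational representation of a simple algebra is a
multiple of the reduced representation, `tr(α) = m Tr(α)`; Prop. 4 with proof (chunks p0048 L13, p0049 L1–L3): `End_Q(A)` is the
total matrix ring of degree `h` over `K′`.  [KaniRosen1989] Thm. A ∕ [Paulhus2008] §2 p. 232: the characters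
`χ_B(w) = tr_ℤ(w ∘ − | Hom(X, B))` decide idempotent relations, i.e. isogeny relations among the `Im ε`.

THE SETTING (all of `§§2–4`): the CM pair `(A, δ)` of level `m` (`Φ_m(δ) = 0` in `End A`, `φ(m) = 2 dim A`, CM type
`S = cmTypeOf A δ m` with finite stabiliser `H′ = Stab(S) ≤ (ℤ/m)ˣ`), `L = ℚ(ζ_m)`; a finite subgroup `H ≤ (ℤ/m)ˣ` and a family
of GALOIS TWISTS `x_v ∈ End A`, `v ∈ H`: `x_v δ = δ^v x_v` (composition order of the tree: `x v ≫ δ = δ^[val v] ≫ x v`),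
normalised by `x_1 = 𝟙_A` — e.g. the integral twist family `(x_v)_{v ∈ H′}` of GEN 47 (`exists_integralTwistFamily`), whose
`ℚ(δ)`-span is the whole crossed product `End⁰(A) = ⊕_{v∈H′} x_v ℚ(δ)`, so that EVERY `w ∈ End A` has coordinates
`N w = ∑_v P_v(δ) x_v` (`N ≥ 1`, `P_v ∈ ℤ[X]`).  `χ_B(w)` is `LinearMap.trace ℤ (A ⟶ B) (leftComp B w)` and `P(δ)` is
`End.asHom (P.eval₂ (Int.castRingHom (End A)) (End.of δ))`.

WHAT THIS FILE PROVES (namespace `Literature.AlgebraicGeometry.HodgeTheory.AbelianVariety`).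
* §1 (only `Φ_m(δ) = 0`): **`trace_leftComp_sum_eval₂_comp_eq`** — `χ_B(∑_{v∈H} P_v(δ) x_v) = χ_B(P_1(δ))`: the characters
  read only the identity coordinate; `trace_leftComp_sum_eval₂_comp_eq_sum_filter` (arbitrary finite families of twists with
  exponents `u_i`: only `u_i = 1` contributes).
* §2 (the character table in coordinates): **`totient_mul_trace_leftComp_sum_eval₂_comp_eq`**
  (`φ(m) · χ_B(∑_v P_v(δ) x_v) = rank_ℤ Hom(A, B) · Tr_{L/ℚ}(P_1(ζ_m))`), **`totient_mul_mul_trace_leftComp_eq_of_nsmul_eq`**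
  (`N w = ∑_v P_v(δ) x_v ⟹ φ(m) N · χ_B(w) = rank_ℤ Hom(A, B) · Tr_{L/ℚ}(P_1(ζ_m))`), **`trace_leftComp_sum_eval₂_comp_self_eq`**
  (`B = A`: `χ_A(∑_v P_v(δ) x_v) = #H′ · Tr_{L/ℚ}(P_1(ζ_m))`).
* §3 (images of integral quasi-idempotents `u² = a u`, `a ≠ 0`, with coordinates `N u = ∑_v P_v(δ) x_v`):
  **`two_mul_mul_mul_dim_image_eq_trace_eval₂`** (`2 a N · dim u(A) = Tr_{L/ℚ}(P_1(ζ_m))` — the dimension of `u(A)` is read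
  off ONE rational number), **`isIsogenous_image_iff_mul_trace_eval₂_eq`** (`u(A) ∼ u′(A) ⟺ b N′ · Tr(P_1(ζ)) = a N · Tr(P′_1(ζ))`),
  **`isSimple_image_iff_card_stabilizer_mul_trace_eval₂_le`** (`u(A)` simple ⟺ `#H′ · Tr(P_1(ζ)) ≤ 2 a N · dim A`),
  **`eq_zero_iff_trace_eval₂_eq_zero`** (`u = 0 ⟺ Tr(P_1(ζ)) = 0`), **`isIsogeny_iff_trace_eval₂_eq`**
  (`u` is an isogeny, i.e. `u(A) = A`, ⟺ `Tr(P_1(ζ)) = 2 a N · dim A`).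

## References
* [Pierce1982] R. S. Pierce, *Associative Algebras*, GTM 88 (1982), §16.3 Prop. b (PDF p0347), §14.1 Example (PDF p0293).
* [Herstein1994] I. N. Herstein, *Noncommutative Rings*, Carus Monograph 15 (1968, repr. 1994), §4.4 Lemma 4.4.2 with proof
  (PDF p0077 L5–L9).
* [Shimura1998] G. Shimura, *Abelian Varieties with Complex Multiplication and Modular Functions* (1998), §5.1 Lemma 1
  (PDF p0046), Prop. 2 with proof (PDF p0047), Props. 3–4 with proofs (chunks p0048–p0049).
* [KaniRosen1989] E. Kani, M. Rosen, *Idempotent relations and factors of Jacobians*, Math. Ann. 284 (1989), Thm. A.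
* [Paulhus2008] J. Paulhus, *Decomposing Jacobians of curves with extra automorphisms*, Acta Arith. 132 (2008), §2 p. 232.
* [MumfordAV1970] D. Mumford, *Abelian Varieties* (1970), §19 Thm. 3 (p. 176: `Hom(X, Y)` is free of finite rank).
-/

noncomputable section

universe u

open Module CategoryTheory CategoryTheory.Limits Polynomial
open scoped Pointwise

namespace Literature.AlgebraicGeometry.HodgeTheory

namespace AbelianVariety

open _root_.AlgebraicGeometry
open Literature.NumberTheory.ComplexMultiplication
open Literature.AlgebraicGeometry.Motives Literature.AlgebraicGeometry.Motives.AbelianVariety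
open Literature.AlgebraicGeometry.Pohlmann1968 Literature.AlgebraicGeometry.Pohlmann1968.Cyclotomic

/-! ## §0 Two more values of the additive character `χ_B` -/

section Linear

variable {K : Type u} [Field K] {X : Motives.AbelianVariety K} (B : Motives.AbelianVariety K)

/-- `χ_B(0) = 0`. [folklore] -/
private theorem trace_leftComp_zero₅₀ :
    LinearMap.trace ℤ (X ⟶ B) (Preadditive.leftComp B (0 : X ⟶ X)).toIntLinearMap = 0 := by
  have h : (Preadditive.leftComp B (0 : X ⟶ X)).toIntLinearMap = 0 := by
    refine LinearMap.ext fun g ↦ ?_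
    change (0 : X ⟶ X) ≫ g = 0
    exact zero_comp
  rw [h, map_zero]

/-- `χ_B(N • f) = N · χ_B(f)`. [folklore] -/
private theorem trace_leftComp_nsmul₅₀ (N : ℕ) (f : X ⟶ X) :
    LinearMap.trace ℤ (X ⟶ B) (Preadditive.leftComp B (N • f)).toIntLinearMap =
      N * LinearMap.trace ℤ (X ⟶ B) (Preadditive.leftComp B f).toIntLinearMap := by
  have h : (Preadditive.leftComp B (N • f)).toIntLinearMap = (N : ℤ) • (Preadditive.leftComp B f).toIntLinearMap := by
    refine LinearMap.ext fun g ↦ ?_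
    change (N • f) ≫ g = (N : ℤ) • (f ≫ g)
    rw [Preadditive.nsmul_comp, natCast_zsmul]
  rw [h, map_smul, smul_eq_mul]

end Linear

/-! ## §1 The characters read only the identity coordinate (only `Φ_m(δ) = 0` is used) -/

section Twists

variable {m : ℕ} [NeZero m] {A : Motives.AbelianVariety ℂ} {δ : A ⟶ A}

/-- **`χ_B(∑_{i∈s} P_i(δ) f_i) = ∑_{i∈s, u_i = 1} χ_B(P_i(δ) f_i)`** for a finite family of Galois twists `f_i δ = δ^{u_i} f_i`
and polynomials `P_i ∈ ℤ[X]`: `P_i(δ) f_i` is again a twist of exponent `u_i`, and the characters vanish on twists of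
exponent `≠ 1` (GEN 48 row 1). [cite: Pierce1982, §16.3 Prop. b (PDF p0347)] [cite: KaniRosen1989, Thm. A] -/
theorem trace_leftComp_sum_eval₂_comp_eq_sum_filter
    (hδ : (cyclotomic m ℤ).eval₂ (Int.castRingHom (End A)) (End.of δ) = 0)
    {I : Type*} (s : Finset I) {f : I → (A ⟶ A)} {u : I → (ZMod m)ˣ}
    (hf : ∀ i ∈ s, f i ≫ δ = End.asHom (End.of δ ^ (u i : ZMod m).val) ≫ f i) (P : I → ℤ[X])
    (B : Motives.AbelianVariety ℂ) :
    LinearMap.trace ℤ (A ⟶ B) (Preadditive.leftComp B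
        (∑ i ∈ s, End.asHom ((P i).eval₂ (Int.castRingHom (End A)) (End.of δ)) ≫ f i)).toIntLinearMap =
      ∑ i ∈ s with u i = 1, LinearMap.trace ℤ (A ⟶ B) (Preadditive.leftComp B
        (End.asHom ((P i).eval₂ (Int.castRingHom (End A)) (End.of δ)) ≫ f i)).toIntLinearMap :=
  trace_leftComp_sum_eq_sum_filter hδ s
    (f := fun i ↦ End.asHom ((P i).eval₂ (Int.castRingHom (End A)) (End.of δ)) ≫ f i)
    (fun i hi ↦ eval₂_comp_comp_eq (hf i hi) (P i)) B

variable {H : Subgroup (ZMod m)ˣ} [Fintype ↥H] {x : ↥H → (A ⟶ A)}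

/-- **The characters read only the identity coordinate: `χ_B(∑_{v∈H} P_v(δ) x_v) = χ_B(P_1(δ))`** for a family of Galois
twists `x_v δ = δ^v x_v` indexed by a finite subgroup `H ≤ (ℤ/m)ˣ` with `x_1 = 1` («`d_{σσ} = c_1^σ`»: the reduced trace of
`∑ u_ρ c_ρ` is `T(c_1)`). [cite: Pierce1982, §16.3 Prop. b (PDF p0347)] [cite: Herstein1994, §4.4 Lemma 4.4.2 with proof (PDF p0077 L5–L9)] [cite: KaniRosen1989, Thm. A] -/
theorem trace_leftComp_sum_eval₂_comp_eq
    (hδ : (cyclotomic m ℤ).eval₂ (Int.castRingHom (End A)) (End.of δ) = 0)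
    (hx : ∀ v : ↥H, x v ≫ δ = End.asHom (End.of δ ^ ((v : (ZMod m)ˣ) : ZMod m).val) ≫ x v) (h1 : x 1 = 𝟙 A)
    (P : ↥H → ℤ[X]) (B : Motives.AbelianVariety ℂ) :
    LinearMap.trace ℤ (A ⟶ B) (Preadditive.leftComp B
        (∑ v, End.asHom ((P v).eval₂ (Int.castRingHom (End A)) (End.of δ)) ≫ x v)).toIntLinearMap =
      LinearMap.trace ℤ (A ⟶ B) (Preadditive.leftComp B
        (End.asHom ((P 1).eval₂ (Int.castRingHom (End A)) (End.of δ)))).toIntLinearMap := by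
  rw [trace_leftComp_sum, Finset.sum_eq_single (1 : ↥H)]
  · rw [h1, Category.comp_id]
  · intro v _ hv
    have hv' : (v : (ZMod m)ˣ) ≠ 1 := fun h ↦ hv (Subtype.ext (by rw [h, OneMemClass.coe_one]))
    exact trace_leftComp_eq_zero_of_comp_eq_pow_val_comp hδ hv' (eval₂_comp_comp_eq (hx v) (P v)) B
  · exact fun h ↦ absurd (Finset.mem_univ _) h

end Twists

/-! ## §2 The character table of the CM pair in crossed-product coordinates -/

section Pair

variable {m : ℕ} [NeZero m] {A : Motives.AbelianVariety ℂ} {δ : A ⟶ A} {S : Finset (ZMod m)}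
  {H : Subgroup (ZMod m)ˣ} [Fintype ↥H] {x : ↥H → (A ⟶ A)}

/-- **`φ(m) · χ_B(∑_{v∈H} P_v(δ) x_v) = rank_ℤ Hom(A, B) · Tr_{ℚ(ζ_m)/ℚ}(P_1(ζ_m))`** — the `ℚ`-character table of the CM pair
`(A, δ)` (`Φ_m(δ) = 0`, `φ(m) = 2 dim A`, `H′` finite) in crossed-product coordinates: twists `x_v δ = δ^v x_v` (`v ∈ H`, a finite
subgroup of `(ℤ/m)ˣ`, `x_1 = 1`), coefficients `P_v(δ) ∈ ℤ[δ]`, any abelian variety `B`.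
[cite: Pierce1982, §16.3 Prop. b (PDF p0347)] [cite: Shimura1998, §5.1 Lemma 1 (PDF p0046), Prop. 2 with proof (PDF p0047), Prop. 4 with proof (chunks p0048 L13, p0049 L1–L3)] [cite: KaniRosen1989, Thm. A] -/
theorem totient_mul_trace_leftComp_sum_eval₂_comp_eq
    [Fintype ↥(MulAction.stabilizer (ZMod m)ˣ (↑S : Set (ZMod m)))]
    {L : Type} [Field L] [NumberField L] [IsCyclotomicExtension {m} ℚ L]
    (hδ : (cyclotomic m ℤ).eval₂ (Int.castRingHom (End A)) (End.of δ) = 0) (hg : Nat.totient m = 2 * A.dim)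
    (hS : cmTypeOf A δ m = ↑S)
    (hx : ∀ v : ↥H, x v ≫ δ = End.asHom (End.of δ ^ ((v : (ZMod m)ˣ) : ZMod m).val) ≫ x v) (h1 : x 1 = 𝟙 A)
    (P : ↥H → ℤ[X]) (B : Motives.AbelianVariety ℂ) :
    (Nat.totient m : ℚ) * (LinearMap.trace ℤ (A ⟶ B) (Preadditive.leftComp B
        (∑ v, End.asHom ((P v).eval₂ (Int.castRingHom (End A)) (End.of δ)) ≫ x v)).toIntLinearMap : ℤ) =
      (finrank ℤ (A ⟶ B) : ℚ) * Algebra.trace ℚ L ((P 1).eval₂ (Int.castRingHom L) (zetaOf m L)) := by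
  rw [trace_leftComp_sum_eval₂_comp_eq hδ hx h1 P B]
  exact totient_mul_trace_leftComp_eval₂_eq hδ hg hS (P 1) B

/-- **`N w = ∑_{v∈H} P_v(δ) x_v ⟹ φ(m) N · χ_B(w) = rank_ℤ Hom(A, B) · Tr_{ℚ(ζ_m)/ℚ}(P_1(ζ_m))`**: the character table on an
ARBITRARY `w ∈ End A` through its (integral) crossed-product coordinates. [cite: Pierce1982, §16.3 Prop. b (PDF p0347)]
[cite: Shimura1998, §5.1 Prop. 2 with proof (PDF p0047), Prop. 4 with proof (chunks p0048 L13, p0049 L1–L3)] [cite: KaniRosen1989, Thm. A] -/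
theorem totient_mul_mul_trace_leftComp_eq_of_nsmul_eq
    [Fintype ↥(MulAction.stabilizer (ZMod m)ˣ (↑S : Set (ZMod m)))]
    {L : Type} [Field L] [NumberField L] [IsCyclotomicExtension {m} ℚ L]
    (hδ : (cyclotomic m ℤ).eval₂ (Int.castRingHom (End A)) (End.of δ) = 0) (hg : Nat.totient m = 2 * A.dim)
    (hS : cmTypeOf A δ m = ↑S)
    (hx : ∀ v : ↥H, x v ≫ δ = End.asHom (End.of δ ^ ((v : (ZMod m)ˣ) : ZMod m).val) ≫ x v) (h1 : x 1 = 𝟙 A)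
    {P : ↥H → ℤ[X]} {w : A ⟶ A} {N : ℕ}
    (hw : N • w = ∑ v, End.asHom ((P v).eval₂ (Int.castRingHom (End A)) (End.of δ)) ≫ x v)
    (B : Motives.AbelianVariety ℂ) :
    (Nat.totient m * N : ℚ) * (LinearMap.trace ℤ (A ⟶ B) (Preadditive.leftComp B w).toIntLinearMap : ℤ) =
      (finrank ℤ (A ⟶ B) : ℚ) * Algebra.trace ℚ L ((P 1).eval₂ (Int.castRingHom L) (zetaOf m L)) := by
  have h := totient_mul_trace_leftComp_sum_eval₂_comp_eq (L := L) hδ hg hS hx h1 P B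
  rw [← hw, trace_leftComp_nsmul₅₀] at h
  push_cast at h
  linear_combination h

/-- **`χ_A(∑_{v∈H} P_v(δ) x_v) = #H′ · Tr_{ℚ(ζ_m)/ℚ}(P_1(ζ_m))`** (`B = A`; `rank_ℤ End A = φ(m) · #H′`).
[cite: Pierce1982, §16.3 Prop. b (PDF p0347)] [cite: Herstein1994, §4.4 Lemma 4.4.2 with proof (PDF p0077 L5–L9)] [cite: Shimura1998, §5.1 Prop. 4 with proof (chunks p0048 L13, p0049 L1–L3)] -/
theorem trace_leftComp_sum_eval₂_comp_self_eq
    [Fintype ↥(MulAction.stabilizer (ZMod m)ˣ (↑S : Set (ZMod m)))]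
    {L : Type} [Field L] [NumberField L] [IsCyclotomicExtension {m} ℚ L]
    (hδ : (cyclotomic m ℤ).eval₂ (Int.castRingHom (End A)) (End.of δ) = 0) (hg : Nat.totient m = 2 * A.dim)
    (hS : cmTypeOf A δ m = ↑S)
    (hx : ∀ v : ↥H, x v ≫ δ = End.asHom (End.of δ ^ ((v : (ZMod m)ˣ) : ZMod m).val) ≫ x v) (h1 : x 1 = 𝟙 A)
    (P : ↥H → ℤ[X]) :
    ((LinearMap.trace ℤ (A ⟶ A) (Preadditive.leftComp A
        (∑ v, End.asHom ((P v).eval₂ (Int.castRingHom (End A)) (End.of δ)) ≫ x v)).toIntLinearMap : ℤ) : ℚ) =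
      (Fintype.card ↥(MulAction.stabilizer (ZMod m)ˣ (↑S : Set (ZMod m))) : ℚ) *
        Algebra.trace ℚ L ((P 1).eval₂ (Int.castRingHom L) (zetaOf m L)) := by
  rw [trace_leftComp_sum_eval₂_comp_eq hδ hx h1 P A]
  exact trace_leftComp_eval₂_self_eq hδ hg hS (P 1)

/-! ## §3 Images of integral quasi-idempotents in coordinates: dimension, isogeny class, simplicity, vanishing -/

/-- **`2 a N · dim u(A) = Tr_{ℚ(ζ_m)/ℚ}(P_1(ζ_m))`** for an integral quasi-idempotent `u² = a u`, `a ≠ 0`, of the CM pair with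
crossed-product coordinates `N u = ∑_{v∈H} P_v(δ) x_v`: `2 · #H′ · a · dim u(A) = Tr_{End⁰(A)ᵒᵖ/ℚ}(op(1 ⊗ u)) = χ_A(u)`
(GEN 49 rows 5–6) and `N χ_A(u) = χ_A(N u) = #H′ · Tr(P_1(ζ_m))` (§2).  The dimension of the Kani–Rosen factor `u(A)` is read
off one rational number. [cite: Shimura1998, §5.1 Prop. 2 with proof (PDF p0047), Prop. 4 with proof (chunks p0048 L13, p0049 L1–L3)] [cite: KaniRosen1989, Thm. A] [cite: Pierce1982, §16.3 Prop. b (PDF p0347)] -/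
theorem two_mul_mul_mul_dim_image_eq_trace_eval₂
    [Fintype ↥(MulAction.stabilizer (ZMod m)ˣ (↑S : Set (ZMod m)))]
    {L : Type} [Field L] [NumberField L] [IsCyclotomicExtension {m} ℚ L]
    (hδ : (cyclotomic m ℤ).eval₂ (Int.castRingHom (End A)) (End.of δ) = 0) (hg : Nat.totient m = 2 * A.dim)
    (hS : cmTypeOf A δ m = ↑S)
    (hx : ∀ v : ↥H, x v ≫ δ = End.asHom (End.of δ ^ ((v : (ZMod m)ˣ) : ZMod m).val) ≫ x v) (h1 : x 1 = 𝟙 A)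
    {P : ↥H → ℤ[X]} {u : A ⟶ A} {N a : ℕ}
    (hNu : N • u = ∑ v, End.asHom ((P v).eval₂ (Int.castRingHom (End A)) (End.of δ)) ≫ x v)
    (hu : u ≫ u = a • u) (ha : a ≠ 0) :
    (2 * a * N * (image u).dim : ℚ) = Algebra.trace ℚ L ((P 1).eval₂ (Int.castRingHom L) (zetaOf m L)) := by
  have k1 := two_mul_card_stabilizer_mul_mul_dim_image_eq hδ hg hS hu ha
  have k2 := trace_leftComp_self_eq_trace_lmul_op u
  have k3 := trace_leftComp_sum_eval₂_comp_self_eq (L := L) hδ hg hS hx h1 P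
  rw [← hNu, trace_leftComp_nsmul₅₀] at k3
  push_cast at k3
  have hH : (Fintype.card ↥(MulAction.stabilizer (ZMod m)ˣ (↑S : Set (ZMod m))) : ℚ) ≠ 0 :=
    Nat.cast_ne_zero.2 Fintype.card_ne_zero
  refine mul_left_cancel₀ hH ?_
  linear_combination (N : ℚ) * k1 - (N : ℚ) * k2 + k3

/-- **`u(A) ∼ u′(A) ⟺ b N′ · Tr(P_1(ζ_m)) = a N · Tr(P′_1(ζ_m))`** for two integral quasi-idempotents `u² = a u`, `u′² = b u′`
(`a, b ≠ 0`) with coordinates `N u = ∑_v P_v(δ) x_v`, `N′ u′ = ∑_v P′_v(δ) x_v`: the isogeny class of a Kani–Rosen factor of the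
CM pair is decided by the trace of its identity coordinate (`u(A) ∼ u′(A) ⟺ dim u(A) = dim u′(A)`, GEN 49 row 7).
[cite: KaniRosen1989, Thm. A] [cite: Paulhus2008, §2 p. 232] [cite: Shimura1998, §5.1 Prop. 4 with proof (chunks p0048 L13, p0049 L1–L3)] -/
theorem isIsogenous_image_iff_mul_trace_eval₂_eq
    [Fintype ↥(MulAction.stabilizer (ZMod m)ˣ (↑S : Set (ZMod m)))]
    {L : Type} [Field L] [NumberField L] [IsCyclotomicExtension {m} ℚ L]
    (hδ : (cyclotomic m ℤ).eval₂ (Int.castRingHom (End A)) (End.of δ) = 0) (hg : Nat.totient m = 2 * A.dim)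
    (hS : cmTypeOf A δ m = ↑S)
    (hx : ∀ v : ↥H, x v ≫ δ = End.asHom (End.of δ ^ ((v : (ZMod m)ˣ) : ZMod m).val) ≫ x v) (h1 : x 1 = 𝟙 A)
    {P P' : ↥H → ℤ[X]} {u u' : A ⟶ A} {N N' a b : ℕ} (hN : N ≠ 0)
    (hNu : N • u = ∑ v, End.asHom ((P v).eval₂ (Int.castRingHom (End A)) (End.of δ)) ≫ x v)
    (hu : u ≫ u = a • u) (ha : a ≠ 0) (hN' : N' ≠ 0)
    (hNu' : N' • u' = ∑ v, End.asHom ((P' v).eval₂ (Int.castRingHom (End A)) (End.of δ)) ≫ x v)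
    (hu' : u' ≫ u' = b • u') (hb : b ≠ 0) :
    IsIsogenous (image u) (image u') ↔
      (b * N' : ℚ) * Algebra.trace ℚ L ((P 1).eval₂ (Int.castRingHom L) (zetaOf m L)) =
        (a * N : ℚ) * Algebra.trace ℚ L ((P' 1).eval₂ (Int.castRingHom L) (zetaOf m L)) := by
  rw [isIsogenous_image_iff_dim_eq_pair hδ hg hS hu ha hu' hb]
  have k1 := two_mul_mul_mul_dim_image_eq_trace_eval₂ (L := L) hδ hg hS hx h1 hNu hu ha
  have k2 := two_mul_mul_mul_dim_image_eq_trace_eval₂ (L := L) hδ hg hS hx h1 hNu' hu' hb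
  constructor
  · intro h
    rw [← k1, ← k2, show ((image u).dim : ℚ) = (image u').dim by exact_mod_cast h]
    ring
  · intro h
    have hc : (2 * a * N : ℚ) * (2 * b * N') ≠ 0 := by
      have : (a : ℚ) ≠ 0 := Nat.cast_ne_zero.2 ha
      have : (b : ℚ) ≠ 0 := Nat.cast_ne_zero.2 hb
      have : (N : ℚ) ≠ 0 := Nat.cast_ne_zero.2 hN
      have : (N' : ℚ) ≠ 0 := Nat.cast_ne_zero.2 hN'
      positivity
    have h' : (2 * a * N : ℚ) * (2 * b * N') * ((image u).dim : ℚ) = (2 * a * N : ℚ) * (2 * b * N') * (image u').dim := by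
      linear_combination (2 * b * N' : ℚ) * k1 - (2 * a * N : ℚ) * k2 + 2 * h
    exact_mod_cast mul_left_cancel₀ hc h'

/-- **`u(A)` is simple ⟺ `#H′ · Tr(P_1(ζ_m)) ≤ 2 a N · dim A`** for an integral quasi-idempotent `u² = a u`, `a ≠ 0`, with
coordinates `N u = ∑_v P_v(δ) x_v` (`u(A)` simple ⟺ `#H′ · dim u(A) ≤ dim A`, GEN 49 row 7, and §3).
[cite: Shimura1998, §5.1 Props. 3, 4 with proofs (chunks p0048 L1–L13, p0049 L1–L3)] [cite: MumfordAV1970, §19 Cor. 2 of Thm. 1 (p. 174)] [cite: KaniRosen1989, Thm. A] -/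
theorem isSimple_image_iff_card_stabilizer_mul_trace_eval₂_le
    [Fintype ↥(MulAction.stabilizer (ZMod m)ˣ (↑S : Set (ZMod m)))]
    {L : Type} [Field L] [NumberField L] [IsCyclotomicExtension {m} ℚ L]
    (hδ : (cyclotomic m ℤ).eval₂ (Int.castRingHom (End A)) (End.of δ) = 0) (hg : Nat.totient m = 2 * A.dim)
    (hS : cmTypeOf A δ m = ↑S)
    (hx : ∀ v : ↥H, x v ≫ δ = End.asHom (End.of δ ^ ((v : (ZMod m)ˣ) : ZMod m).val) ≫ x v) (h1 : x 1 = 𝟙 A)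
    {P : ↥H → ℤ[X]} {u : A ⟶ A} {N a : ℕ} (hN : N ≠ 0)
    (hNu : N • u = ∑ v, End.asHom ((P v).eval₂ (Int.castRingHom (End A)) (End.of δ)) ≫ x v)
    (hu : u ≫ u = a • u) (ha : a ≠ 0) :
    (image u).IsSimple ↔
      (Fintype.card ↥(MulAction.stabilizer (ZMod m)ˣ (↑S : Set (ZMod m))) : ℚ) *
          Algebra.trace ℚ L ((P 1).eval₂ (Int.castRingHom L) (zetaOf m L)) ≤ 2 * a * N * A.dim := by
  rw [isSimple_image_iff_card_stabilizer_mul_dim_le hδ hg hS hu ha]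
  have k1 := two_mul_mul_mul_dim_image_eq_trace_eval₂ (L := L) hδ hg hS hx h1 hNu hu ha
  have hpos : (0 : ℚ) < 2 * a * N := by
    have : 0 < a := Nat.pos_of_ne_zero ha
    have : 0 < N := Nat.pos_of_ne_zero hN
    positivity
  rw [← k1]
  constructor
  · intro h
    have h' : ((Fintype.card ↥(MulAction.stabilizer (ZMod m)ˣ (↑S : Set (ZMod m))) * (image u).dim : ℕ) : ℚ) ≤ A.dim := by
      exact_mod_cast h
    calc (Fintype.card ↥(MulAction.stabilizer (ZMod m)ˣ (↑S : Set (ZMod m))) : ℚ) * (2 * a * N * ((image u).dim : ℚ))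
        = (2 * a * N) * ((Fintype.card ↥(MulAction.stabilizer (ZMod m)ˣ (↑S : Set (ZMod m))) * (image u).dim : ℕ) : ℚ) := by
          push_cast; ring
      _ ≤ (2 * a * N) * (A.dim : ℚ) := mul_le_mul_of_nonneg_left h' hpos.le
      _ = 2 * a * N * A.dim := by ring
  · intro h
    have h' : (2 * a * N : ℚ) * ((Fintype.card ↥(MulAction.stabilizer (ZMod m)ˣ (↑S : Set (ZMod m))) * (image u).dim : ℕ) : ℚ) ≤
        (2 * a * N : ℚ) * (A.dim : ℚ) := by
      calc (2 * a * N : ℚ) * ((Fintype.card ↥(MulAction.stabilizer (ZMod m)ˣ (↑S : Set (ZMod m))) * (image u).dim : ℕ) : ℚ)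
          = (Fintype.card ↥(MulAction.stabilizer (ZMod m)ˣ (↑S : Set (ZMod m))) : ℚ) * (2 * a * N * ((image u).dim : ℚ)) := by
            push_cast; ring
        _ ≤ 2 * a * N * A.dim := h
        _ = (2 * a * N : ℚ) * (A.dim : ℚ) := by ring
    exact_mod_cast le_of_mul_le_mul_left h' hpos

/-- **`u = 0 ⟺ Tr(P_1(ζ_m)) = 0`** for an integral quasi-idempotent `u² = a u`, `a ≠ 0`, with coordinates
`N u = ∑_v P_v(δ) x_v`: `χ_A(0) = 0`, and conversely `dim u(A) = 0` forces `u = 0` (a non-zero homomorphism has a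
positive-dimensional image). [cite: KaniRosen1989, Thm. A] [cite: Pierce1982, §16.3 Prop. b (PDF p0347)] [cite: Shimura1998, §5.1 Prop. 4 with proof (chunks p0048 L13, p0049 L1–L3)] -/
theorem eq_zero_iff_trace_eval₂_eq_zero
    [Fintype ↥(MulAction.stabilizer (ZMod m)ˣ (↑S : Set (ZMod m)))]
    {L : Type} [Field L] [NumberField L] [IsCyclotomicExtension {m} ℚ L]
    (hδ : (cyclotomic m ℤ).eval₂ (Int.castRingHom (End A)) (End.of δ) = 0) (hg : Nat.totient m = 2 * A.dim)
    (hS : cmTypeOf A δ m = ↑S)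
    (hx : ∀ v : ↥H, x v ≫ δ = End.asHom (End.of δ ^ ((v : (ZMod m)ˣ) : ZMod m).val) ≫ x v) (h1 : x 1 = 𝟙 A)
    {P : ↥H → ℤ[X]} {u : A ⟶ A} {N a : ℕ} (hN : N ≠ 0)
    (hNu : N • u = ∑ v, End.asHom ((P v).eval₂ (Int.castRingHom (End A)) (End.of δ)) ≫ x v)
    (hu : u ≫ u = a • u) (ha : a ≠ 0) :
    u = 0 ↔ Algebra.trace ℚ L ((P 1).eval₂ (Int.castRingHom L) (zetaOf m L)) = 0 := by
  have k1 := two_mul_mul_mul_dim_image_eq_trace_eval₂ (L := L) hδ hg hS hx h1 hNu hu ha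
  constructor
  · intro h0
    have k3 := trace_leftComp_sum_eval₂_comp_self_eq (L := L) hδ hg hS hx h1 P
    rw [← hNu, h0, smul_zero, trace_leftComp_zero₅₀] at k3
    have hH : (Fintype.card ↥(MulAction.stabilizer (ZMod m)ˣ (↑S : Set (ZMod m))) : ℚ) ≠ 0 :=
      Nat.cast_ne_zero.2 Fintype.card_ne_zero
    push_cast at k3
    exact (mul_eq_zero.1 k3.symm).resolve_left hH
  · intro hT
    by_contra h0
    have hpos := dim_image_pos u h0
    rw [hT] at k1
    have : ((image u).dim : ℚ) = 0 := by
      have ha' : (a : ℚ) ≠ 0 := Nat.cast_ne_zero.2 ha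
      have hN' : (N : ℚ) ≠ 0 := Nat.cast_ne_zero.2 hN
      have h2 : (2 * a * N : ℚ) ≠ 0 := by positivity
      exact (mul_eq_zero.1 k1).resolve_left h2
    exact absurd (by exact_mod_cast this : (image u).dim = 0) hpos.ne'

/-- **`u` is an isogeny (`u(A) = A`) ⟺ `Tr(P_1(ζ_m)) = 2 a N · dim A`** for an integral quasi-idempotent `u² = a u`, `a ≠ 0`,
with coordinates `N u = ∑_v P_v(δ) x_v`: an isogeny is finite, so `dim u(A) = dim A`; conversely `dim u(A) = dim A` makes
`u(A) ↪ A` surjective and a surjective endomorphism is an isogeny. [cite: KaniRosen1989, Thm. A] [cite: MumfordAV1970, §19 Thm. 1 (p. 173) and Remark p. 169]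
[cite: Shimura1998, §5.1 Prop. 4 with proof (chunks p0048 L13, p0049 L1–L3)] -/
theorem isIsogeny_iff_trace_eval₂_eq
    [Fintype ↥(MulAction.stabilizer (ZMod m)ˣ (↑S : Set (ZMod m)))]
    {L : Type} [Field L] [NumberField L] [IsCyclotomicExtension {m} ℚ L]
    (hδ : (cyclotomic m ℤ).eval₂ (Int.castRingHom (End A)) (End.of δ) = 0) (hg : Nat.totient m = 2 * A.dim)
    (hS : cmTypeOf A δ m = ↑S)
    (hx : ∀ v : ↥H, x v ≫ δ = End.asHom (End.of δ ^ ((v : (ZMod m)ˣ) : ZMod m).val) ≫ x v) (h1 : x 1 = 𝟙 A)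
    {P : ↥H → ℤ[X]} {u : A ⟶ A} {N a : ℕ} (hN : N ≠ 0)
    (hNu : N • u = ∑ v, End.asHom ((P v).eval₂ (Int.castRingHom (End A)) (End.of δ)) ≫ x v)
    (hu : u ≫ u = a • u) (ha : a ≠ 0) :
    IsIsogeny u ↔ Algebra.trace ℚ L ((P 1).eval₂ (Int.castRingHom L) (zetaOf m L)) = 2 * a * N * A.dim := by
  have k1 := two_mul_mul_mul_dim_image_eq_trace_eval₂ (L := L) hδ hg hS hx h1 hNu hu ha
  constructor
  · intro hiso
    haveI := hiso.2
    rw [← k1, dim_image_eq_of_isFinite u]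
  · intro hT
    rw [hT] at k1
    have hd : (image u).dim = A.dim := by
      have ha' : (a : ℚ) ≠ 0 := Nat.cast_ne_zero.2 ha
      have hN' : (N : ℚ) ≠ 0 := Nat.cast_ne_zero.2 hN
      have h2 : (2 * a * N : ℚ) ≠ 0 := by positivity
      exact_mod_cast mul_left_cancel₀ h2 k1
    haveI := surjective_of_isClosedImmersion_of_dim_eq (imageι u) hd
    haveI : Surjective (Hom.toSchemeHom u) := by
      rw [← toImage_imageι u]
      change Surjective (Hom.toSchemeHom (toImage u) ≫ Hom.toSchemeHom (imageι u))
      infer_instance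
    exact isIsogeny_of_surjective_end u

end Pair

end AbelianVariety

end Literature.AlgebraicGeometry.HodgeTheory

end
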